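import Literature.NumberTheory.LFunctions.KloostermanFractionsFromCbTools
import HarnessLib

/-!
# Trilinear forms with Kloosterman fractions: tools for Bettin–Chandee §6 (general `A`, twisted)

Topic `NumberTheory/LFunctions`.  S. Bettin, V. Chandee, *Trilinear forms with Kloosterman
fractions*, Adv. Math. 328 (2018), §6 "Removing the square-free condition": writing `n = bn'`
(`b` squarefull, `n'` squarefree, `(b,n') = 1`),
`𝓒₁(M,N,A;β,ν) ≪ M^ε ∑_{b squarefull,(b,ϑ)=1} b^{1/2} 𝓒_b(M,N/b,A;β_b,ν)`; then (5.2) for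
`b ≤ B` and "the trivial bound `𝓒_b ≪ ‖ν‖² A (MN/b) ‖β_b‖`" for `b > B`, `B = N^{1/2}`.  This file
PROVES the ingredients for the general-`A`, TWISTED second moment
`𝓒₁^{tw}(M,N,A) = ∑_{M<m≤2M} |∑_a ∑_{n,(m,n)=1} β_n ν_a e(ϑ a m̄/n + η a/(mn))|²` of
`TrilinearKloostermanFractionsFromC1.lean` (the tree's `KloostermanFractionsFromCbTools.lean` is
the case `A = 1`, untwisted; its generic `BC_second_moment_le_sqfull_gen`, `BC_terms6_absorb` and
`sum_sqfull_normSq_betab_eq` are reused):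

* `BC_C1Atw_inner_eq`, **`BC_C1Atw_le_sum_sqfull`** — the squarefull decomposition
  `𝓒₁^{tw} ≤ Z ∑_b b^{1/2} 𝓒_b^{tw}(M,N/b,A;β_b,ν)`, where
  `𝓒_b^{tw}(M,N',A;γ,ν) = ∑_{M<m≤2M,(m,b)=1} |∑_{n'≤2N',(n',m)=1} γ_{n'} ∑_a ν_a e(ϑa m̄^{(bn')}/(bn') + ηa/(m bn'))|²`;
* `BC_norm_phi_le`, `BC_CbAtw_trivial`, `BC_CbAtw_eq_zero_of_forall` — the trivial bound
  `𝓒_b^{tw}(M,N',A) ≤ 8AMN' ‖γ‖²‖ν‖²`;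
* `BC_terms52A_le`, `BC_terms6A_absorb` — the exponents of (5.2) at `N' = N/b` times `b^{1/2}`
  ((6.1)), and the absorptions of §6, with the `A`-powers of the source;
* **`BC_sqrtb_CbA_le`** — one squarefull `b`: from (5.2) (general `A`, twisted; a hypothesis) for
  `b ≤ N^{1/2}` and the trivial bound for `b > N^{1/2}`.

The assembly ((5.2) ⟹ (6.4), with the Weil range of `TrilinearKloostermanFractionsWeilRange.lean`)
is `TrilinearKloostermanFractionsFromCb.lean`.  No new named facts (D-0026).

## References

* S. Bettin, V. Chandee, *Trilinear forms with Kloosterman fractions*, Adv. Math. 328 (2018)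
  1234–1262, arXiv:1502.00769, §6 ((6.1), (6.2)), (5.2). [BettinChandee2018]
-/

noncomputable section

open Finset Real

namespace Literature.NumberTheory.LFunctions

/-! ### The squarefull decomposition of the twisted trilinear second moment -/

/-- Moving the `a`-sum inside: `∑_a ∑_n [(m,n)=1] β_n ν_a e_a(m,n) = ∑_n [(m,n)=1] β_n φ(m,n)` with
`φ(m,n) = ∑_a ν_a e(ϑ a m̄/n + η a/(mn))`. [folklore] -/
theorem BC_C1Atw_inner_eq (N A : ℝ) (ϑ : ℤ) (η : ℝ) (β ν : ℕ → ℂ) (m : ℕ) :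
    (∑ a ∈ Icc 1 ⌊2 * A⌋₊, ∑ n ∈ Icc 1 ⌊2 * N⌋₊,
      (if m.Coprime n then
        β n * ν a * Complex.exp (2 * Real.pi * Complex.I *
          ((ϑ : ℂ) * (a : ℂ) * ((((m : ZMod n)⁻¹).val : ℕ) : ℂ) / (n : ℂ) +
            (η : ℂ) * (a : ℂ) / ((m : ℂ) * (n : ℂ))))
      else 0)) =
      ∑ n ∈ Icc 1 ⌊2 * N⌋₊, (if m.Coprime n then β n *
        (∑ a ∈ Icc 1 ⌊2 * A⌋₊, ν a * Complex.exp (2 * Real.pi * Complex.I *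
          ((ϑ : ℂ) * (a : ℂ) * ((((m : ZMod n)⁻¹).val : ℕ) : ℂ) / (n : ℂ) +
            (η : ℂ) * (a : ℂ) / ((m : ℂ) * (n : ℂ))))) else 0) := by
  rw [Finset.sum_comm]
  refine Finset.sum_congr rfl fun n _ => ?_
  by_cases h : m.Coprime n
  · simp only [if_pos h, Finset.mul_sum]
    refine Finset.sum_congr rfl fun a _ => ?_
    ring
  · simp only [if_neg h, Finset.sum_const_zero]

/-- **`𝓒₁^{tw} ≤ Z · ∑_b b^{1/2} 𝓒_b^{tw}(M, N/b, A; β_b, ν)`** (Bettin–Chandee §6, first half, for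
the twisted trilinear second moment; the tree's `BC_second_moment_le_sqfull_gen` with
`φ(m,n) = ∑_a ν_a e(ϑ a m̄/n + η a/(mn))`): with `Z = ∑_{b ≤ 2N squarefull} b^{-1/2}` and
`β_b(n') = μ²(n') 1_{(n',b)=1} β_{bn'}`,
`∑_{M<m≤2M} |∑_a ∑_{n,(m,n)=1} β_n ν_a e(…)|² ≤ Z ∑_{b ≤ 2N sqfull} b^{1/2}
∑_{M<m≤2M,(m,b)=1} |∑_{n' ≤ 2N/b,(n',m)=1} β_b(n') ∑_a ν_a e(ϑ a m̄^{(bn')}/(bn') + η a/(m·bn'))|²`.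
[cite: BettinChandee2018, §6] -/
theorem BC_C1Atw_le_sum_sqfull (M N A : ℝ) (ϑ : ℤ) (η : ℝ) (β ν : ℕ → ℂ) :
    ∑ m ∈ Ioc ⌊M⌋₊ ⌊2 * M⌋₊, ‖∑ a ∈ Icc 1 ⌊2 * A⌋₊, ∑ n ∈ Icc 1 ⌊2 * N⌋₊,
        (if m.Coprime n then
          β n * ν a * Complex.exp (2 * Real.pi * Complex.I *
            ((ϑ : ℂ) * (a : ℂ) * ((((m : ZMod n)⁻¹).val : ℕ) : ℂ) / (n : ℂ) +
              (η : ℂ) * (a : ℂ) / ((m : ℂ) * (n : ℂ))))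
        else 0)‖ ^ 2 ≤
      (∑ b ∈ (Icc 1 ⌊2 * N⌋₊).filter (fun b => ∀ p ∈ b.primeFactors, p ^ 2 ∣ b),
          (Real.sqrt b)⁻¹) *
        ∑ b ∈ (Icc 1 ⌊2 * N⌋₊).filter (fun b => ∀ p ∈ b.primeFactors, p ^ 2 ∣ b),
          Real.sqrt b * ∑ m ∈ (Ioc ⌊M⌋₊ ⌊2 * M⌋₊).filter (fun m => m.Coprime b),
            ‖∑ n' ∈ (Icc 1 ⌊2 * (N / b)⌋₊).filter (fun n' => n'.Coprime m),
              (if Squarefree n' ∧ n'.Coprime b then β (b * n') else 0) *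
                ∑ a ∈ Icc 1 ⌊2 * A⌋₊, ν a * Complex.exp (2 * Real.pi * Complex.I *
                  ((ϑ : ℂ) * (a : ℂ) * ((((m : ZMod (b * n'))⁻¹).val : ℕ) : ℂ) / ((b * n' : ℕ) : ℂ) +
                    (η : ℂ) * (a : ℂ) / ((m : ℂ) * ((b * n' : ℕ) : ℂ))))‖ ^ 2 := by
  have h := BC_second_moment_le_sqfull_gen (Ioc ⌊M⌋₊ ⌊2 * M⌋₊) ⌊2 * N⌋₊ β
    (fun m n => ∑ a ∈ Icc 1 ⌊2 * A⌋₊, ν a * Complex.exp (2 * Real.pi * Complex.I *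
      ((ϑ : ℂ) * (a : ℂ) * ((((m : ZMod n)⁻¹).val : ℕ) : ℂ) / (n : ℂ) +
        (η : ℂ) * (a : ℂ) / ((m : ℂ) * (n : ℂ)))))
  have hfl : ∀ b : ℕ, ⌊2 * (N / b)⌋₊ = ⌊2 * N⌋₊ / b := fun b => by
    rw [show (2 : ℝ) * (N / b) = 2 * N / b by ring, Nat.floor_div_natCast]
  simp_rw [BC_C1Atw_inner_eq]
  refine h.trans (le_of_eq ?_)
  congr 1
  refine Finset.sum_congr rfl fun b _ => ?_
  congr 1
  refine Finset.sum_congr rfl fun m _ => ?_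
  rw [hfl b]

/-- The inner phase sum `φ(m,n) = ∑_a ν_a e(…)` is bounded by `(2A)^{1/2} ‖ν‖`. [folklore] -/
theorem BC_norm_phi_le {A : ℝ} (hA : 0 ≤ A) (ϑ : ℤ) (η : ℝ) (ν : ℕ → ℂ) (m n : ℕ) :
    ‖∑ a ∈ Icc 1 ⌊2 * A⌋₊, ν a * Complex.exp (2 * Real.pi * Complex.I *
        ((ϑ : ℂ) * (a : ℂ) * ((((m : ZMod n)⁻¹).val : ℕ) : ℂ) / (n : ℂ) +
          (η : ℂ) * (a : ℂ) / ((m : ℂ) * (n : ℂ))))‖ ≤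
      Real.sqrt (2 * A) * Real.sqrt (∑ a ∈ Icc 1 ⌊2 * A⌋₊, ‖ν a‖ ^ 2) := by
  calc _ ≤ ∑ a ∈ Icc 1 ⌊2 * A⌋₊, ‖ν a * Complex.exp (2 * Real.pi * Complex.I *
        ((ϑ : ℂ) * (a : ℂ) * ((((m : ZMod n)⁻¹).val : ℕ) : ℂ) / (n : ℂ) +
          (η : ℂ) * (a : ℂ) / ((m : ℂ) * (n : ℂ))))‖ := norm_sum_le _ _
    _ = ∑ a ∈ Icc 1 ⌊2 * A⌋₊, ‖ν a‖ := by
        refine Finset.sum_congr rfl fun a _ => ?_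
        have h : (2 * Real.pi * Complex.I *
            ((ϑ : ℂ) * (a : ℂ) * ((((m : ZMod n)⁻¹).val : ℕ) : ℂ) / (n : ℂ) +
              (η : ℂ) * (a : ℂ) / ((m : ℂ) * (n : ℂ)))) =
            ((2 * Real.pi * ((ϑ : ℝ) * (a : ℝ) * ((((m : ZMod n)⁻¹).val : ℕ) : ℝ) / (n : ℝ) +
              η * (a : ℝ) / ((m : ℝ) * n)) : ℝ) : ℂ) * Complex.I := by
          push_cast; ring
        rw [norm_mul, h, Complex.norm_exp_ofReal_mul_I, mul_one]
    _ ≤ _ := by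
        -- Cauchy–Schwarz on the box `1 ≤ a ≤ 2A`
        have hcard : ((Icc 1 ⌊2 * A⌋₊).card : ℝ) ≤ 2 * A := by
          rw [Nat.card_Icc]; simpa using Nat.floor_le (by positivity : (0 : ℝ) ≤ 2 * A)
        have h1 : (∑ a ∈ Icc 1 ⌊2 * A⌋₊, ‖ν a‖) ^ 2 ≤ (2 * A) * ∑ a ∈ Icc 1 ⌊2 * A⌋₊, ‖ν a‖ ^ 2 :=
          sq_sum_le_card_mul_sum_sq.trans (mul_le_mul_of_nonneg_right hcard
            (Finset.sum_nonneg fun _ _ => sq_nonneg _))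
        calc ∑ a ∈ Icc 1 ⌊2 * A⌋₊, ‖ν a‖ = Real.sqrt ((∑ a ∈ Icc 1 ⌊2 * A⌋₊, ‖ν a‖) ^ 2) :=
              (Real.sqrt_sq (Finset.sum_nonneg fun _ _ => norm_nonneg _)).symm
          _ ≤ Real.sqrt ((2 * A) * ∑ a ∈ Icc 1 ⌊2 * A⌋₊, ‖ν a‖ ^ 2) := Real.sqrt_le_sqrt h1
          _ = _ := Real.sqrt_mul (by positivity) _

/-- **Trivial bound** for the twisted trilinear `𝓒_b`-moment (Bettin–Chandee §6: "For `b > B` we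
apply the trivial bound `𝓒_b(M,N/b,A,β_b,ν) ≪ ‖ν‖² A (MN/b) ‖β_b‖²`"): for `M, N', A ≥ 0`,
`∑_{M<m≤2M,(m,b)=1} |∑_{n' ≤ 2N',(n',m)=1} γ_{n'} φ(m, bn')|² ≤ 8 A M N' ‖γ‖² ‖ν‖²`.
[cite: BettinChandee2018, §6] -/
theorem BC_CbAtw_trivial (b : ℕ) {M N' A : ℝ} (hM : 0 ≤ M) (hN' : 0 ≤ N') (hA : 0 ≤ A) (ϑ : ℤ)
    (η : ℝ) (γ ν : ℕ → ℂ) :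
    ∑ m ∈ (Ioc ⌊M⌋₊ ⌊2 * M⌋₊).filter (fun m => m.Coprime b),
        ‖∑ n' ∈ (Icc 1 ⌊2 * N'⌋₊).filter (fun n' => n'.Coprime m),
          γ n' * ∑ a ∈ Icc 1 ⌊2 * A⌋₊, ν a * Complex.exp (2 * Real.pi * Complex.I *
            ((ϑ : ℂ) * (a : ℂ) * ((((m : ZMod (b * n'))⁻¹).val : ℕ) : ℂ) / ((b * n' : ℕ) : ℂ) +
              (η : ℂ) * (a : ℂ) / ((m : ℂ) * ((b * n' : ℕ) : ℂ))))‖ ^ 2 ≤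
      8 * A * M * N' * (∑ n ∈ Icc 1 ⌊2 * N'⌋₊, ‖γ n‖ ^ 2) *
        (∑ a ∈ Icc 1 ⌊2 * A⌋₊, ‖ν a‖ ^ 2) := by
  set nγ2 : ℝ := ∑ n ∈ Icc 1 ⌊2 * N'⌋₊, ‖γ n‖ ^ 2 with hnγ2
  set nν2 : ℝ := ∑ a ∈ Icc 1 ⌊2 * A⌋₊, ‖ν a‖ ^ 2 with hnν2
  have hnγ0 : 0 ≤ nγ2 := Finset.sum_nonneg fun _ _ => sq_nonneg _
  have hnν0 : 0 ≤ nν2 := Finset.sum_nonneg fun _ _ => sq_nonneg _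
  have hcardM : (((Ioc ⌊M⌋₊ ⌊2 * M⌋₊).filter (fun m => m.Coprime b)).card : ℝ) ≤ 2 * M := by
    calc (((Ioc ⌊M⌋₊ ⌊2 * M⌋₊).filter (fun m => m.Coprime b)).card : ℝ)
        ≤ ((Ioc ⌊M⌋₊ ⌊2 * M⌋₊).card : ℝ) := by exact_mod_cast Finset.card_filter_le _ _
      _ = ((⌊2 * M⌋₊ - ⌊M⌋₊ : ℕ) : ℝ) := by rw [Nat.card_Ioc]
      _ ≤ (⌊2 * M⌋₊ : ℝ) := by exact_mod_cast Nat.sub_le _ _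
      _ ≤ 2 * M := Nat.floor_le (by positivity)
  have hinner : ∀ m : ℕ, ‖∑ n' ∈ (Icc 1 ⌊2 * N'⌋₊).filter (fun n' => n'.Coprime m),
      γ n' * ∑ a ∈ Icc 1 ⌊2 * A⌋₊, ν a * Complex.exp (2 * Real.pi * Complex.I *
        ((ϑ : ℂ) * (a : ℂ) * ((((m : ZMod (b * n'))⁻¹).val : ℕ) : ℂ) / ((b * n' : ℕ) : ℂ) +
          (η : ℂ) * (a : ℂ) / ((m : ℂ) * ((b * n' : ℕ) : ℂ))))‖ ^ 2 ≤ 4 * A * N' * nγ2 * nν2 := by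
    intro m
    have h1 : ‖∑ n' ∈ (Icc 1 ⌊2 * N'⌋₊).filter (fun n' => n'.Coprime m),
        γ n' * ∑ a ∈ Icc 1 ⌊2 * A⌋₊, ν a * Complex.exp (2 * Real.pi * Complex.I *
          ((ϑ : ℂ) * (a : ℂ) * ((((m : ZMod (b * n'))⁻¹).val : ℕ) : ℂ) / ((b * n' : ℕ) : ℂ) +
            (η : ℂ) * (a : ℂ) / ((m : ℂ) * ((b * n' : ℕ) : ℂ))))‖ ≤
        Real.sqrt (2 * A) * Real.sqrt nν2 * (Real.sqrt (2 * N') * Real.sqrt nγ2) := by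
      calc _ ≤ ∑ n' ∈ (Icc 1 ⌊2 * N'⌋₊).filter (fun n' => n'.Coprime m),
            ‖γ n'‖ * (Real.sqrt (2 * A) * Real.sqrt nν2) := by
            refine (norm_sum_le _ _).trans (Finset.sum_le_sum fun n' _ => ?_)
            rw [norm_mul]
            refine mul_le_mul_of_nonneg_left ?_ (norm_nonneg _)
            have := BC_norm_phi_le hA ϑ η ν m (b * n')
            simpa only [Nat.cast_mul] using this
        _ = (Real.sqrt (2 * A) * Real.sqrt nν2) *
            ∑ n' ∈ (Icc 1 ⌊2 * N'⌋₊).filter (fun n' => n'.Coprime m), ‖γ n'‖ := by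
            rw [Finset.mul_sum]; refine Finset.sum_congr rfl fun _ _ => ?_; ring
        _ ≤ (Real.sqrt (2 * A) * Real.sqrt nν2) * ∑ n' ∈ Icc 1 ⌊2 * N'⌋₊, ‖γ n'‖ := by
            refine mul_le_mul_of_nonneg_left ?_ (by positivity)
            exact Finset.sum_le_sum_of_subset_of_nonneg (Finset.filter_subset _ _)
              fun _ _ _ => norm_nonneg _
        _ ≤ (Real.sqrt (2 * A) * Real.sqrt nν2) * (Real.sqrt (2 * N') * Real.sqrt nγ2) := by
            refine mul_le_mul_of_nonneg_left ?_ (by positivity)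
            -- Cauchy–Schwarz on the box `1 ≤ n' ≤ 2N'`
            have hcard : ((Icc 1 ⌊2 * N'⌋₊).card : ℝ) ≤ 2 * N' := by
              rw [Nat.card_Icc]; simpa using Nat.floor_le (by positivity : (0 : ℝ) ≤ 2 * N')
            have h1 : (∑ n' ∈ Icc 1 ⌊2 * N'⌋₊, ‖γ n'‖) ^ 2 ≤
                (2 * N') * ∑ n' ∈ Icc 1 ⌊2 * N'⌋₊, ‖γ n'‖ ^ 2 :=
              sq_sum_le_card_mul_sum_sq.trans (mul_le_mul_of_nonneg_right hcard
                (Finset.sum_nonneg fun _ _ => sq_nonneg _))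
            calc ∑ n' ∈ Icc 1 ⌊2 * N'⌋₊, ‖γ n'‖
                = Real.sqrt ((∑ n' ∈ Icc 1 ⌊2 * N'⌋₊, ‖γ n'‖) ^ 2) :=
                  (Real.sqrt_sq (Finset.sum_nonneg fun _ _ => norm_nonneg _)).symm
              _ ≤ Real.sqrt ((2 * N') * ∑ n' ∈ Icc 1 ⌊2 * N'⌋₊, ‖γ n'‖ ^ 2) := Real.sqrt_le_sqrt h1
              _ = _ := Real.sqrt_mul (by positivity) _
    calc _ ≤ (Real.sqrt (2 * A) * Real.sqrt nν2 * (Real.sqrt (2 * N') * Real.sqrt nγ2)) ^ 2 :=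
          pow_le_pow_left₀ (norm_nonneg _) h1 2
      _ = 4 * A * N' * nγ2 * nν2 := by
          rw [mul_pow, mul_pow, mul_pow, Real.sq_sqrt (by positivity), Real.sq_sqrt hnν0,
            Real.sq_sqrt (by positivity), Real.sq_sqrt hnγ0]
          ring
  calc _ ≤ ∑ m ∈ (Ioc ⌊M⌋₊ ⌊2 * M⌋₊).filter (fun m => m.Coprime b), 4 * A * N' * nγ2 * nν2 :=
        Finset.sum_le_sum fun m _ => hinner m
    _ = (((Ioc ⌊M⌋₊ ⌊2 * M⌋₊).filter (fun m => m.Coprime b)).card : ℝ) *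
          (4 * A * N' * nγ2 * nν2) := by rw [Finset.sum_const, nsmul_eq_mul]
    _ ≤ (2 * M) * (4 * A * N' * nγ2 * nν2) :=
        mul_le_mul_of_nonneg_right hcardM (by positivity)
    _ = _ := by ring

/-- If `γ` vanishes on `1 ≤ n' ≤ 2N'` then the twisted trilinear `𝓒_b`-moment vanishes. [folklore] -/
theorem BC_CbAtw_eq_zero_of_forall (b : ℕ) (M : ℝ) {N' : ℝ} (A : ℝ) (ϑ : ℤ) (η : ℝ)
    {γ : ℕ → ℂ} (ν : ℕ → ℂ) (h : ∀ n ∈ Icc 1 ⌊2 * N'⌋₊, γ n = 0) :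
    ∑ m ∈ (Ioc ⌊M⌋₊ ⌊2 * M⌋₊).filter (fun m => m.Coprime b),
        ‖∑ n' ∈ (Icc 1 ⌊2 * N'⌋₊).filter (fun n' => n'.Coprime m),
          γ n' * ∑ a ∈ Icc 1 ⌊2 * A⌋₊, ν a * Complex.exp (2 * Real.pi * Complex.I *
            ((ϑ : ℂ) * (a : ℂ) * ((((m : ZMod (b * n'))⁻¹).val : ℕ) : ℂ) / ((b * n' : ℕ) : ℂ) +
              (η : ℂ) * (a : ℂ) / ((m : ℂ) * ((b * n' : ℕ) : ℂ))))‖ ^ 2 = 0 := by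
  refine Finset.sum_eq_zero fun m _ => ?_
  rw [Finset.sum_eq_zero fun n' hn' => ?_, norm_zero]
  · simp
  · rw [h n' (Finset.mem_filter.mp hn').1, zero_mul]

/-! ### The exponents of (5.2) at `N' = N/b`, and the absorptions of §6 (general `A`) -/

/-- **(5.2) at `N' = N/b`, times `b^{1/2}`, general `A`** (Bettin–Chandee (6.1)): for `M, N, A > 0`
and `1 ≤ b ≤ N^{1/2}`,
`b^{1/2} (AM(bN')^{1/2} + b^{3/4}AM^{1/2}N'^{5/4} + AM^{6/5}N'^{1/10}b^{-2/5} + b^{1/5}A^{2/5}M^{6/5}N'^{7/10} + A^{7/10}b^{1/2}M^{3/5}N'^{13/10} + b^{1/2}AN'^{7/4})`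
`≤ AMN^{3/4} + AM^{1/2}N^{5/4} + AM^{6/5}N^{1/10} + A^{2/5}M^{6/5}N^{7/10} + A^{7/10}M^{3/5}N^{13/10} + AN^{7/4}`,
`N' = N/b`. [cite: BettinChandee2018, §6 (6.1)] -/
theorem BC_terms52A_le {M N A b : ℝ} (hM : 0 < M) (hN : 0 < N) (hA : 0 < A) (hb1 : 1 ≤ b)
    (hbN : b ≤ N ^ (1 / 2 : ℝ)) :
    Real.sqrt b * (A * M * (b * (N / b)) ^ (1 / 2 : ℝ) +
        b ^ (3 / 4 : ℝ) * A * M ^ (1 / 2 : ℝ) * (N / b) ^ (5 / 4 : ℝ) +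
        A * M ^ (6 / 5 : ℝ) * (N / b) ^ (1 / 10 : ℝ) * b ^ (-(2 / 5) : ℝ) +
        b ^ (1 / 5 : ℝ) * A ^ (2 / 5 : ℝ) * M ^ (6 / 5 : ℝ) * (N / b) ^ (7 / 10 : ℝ) +
        A ^ (7 / 10 : ℝ) * b ^ (1 / 2 : ℝ) * M ^ (3 / 5 : ℝ) * (N / b) ^ (13 / 10 : ℝ) +
        b ^ (1 / 2 : ℝ) * A * (N / b) ^ (7 / 4 : ℝ)) ≤
      A * M * N ^ (3 / 4 : ℝ) + A * M ^ (1 / 2 : ℝ) * N ^ (5 / 4 : ℝ) +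
        A * M ^ (6 / 5 : ℝ) * N ^ (1 / 10 : ℝ) + A ^ (2 / 5 : ℝ) * M ^ (6 / 5 : ℝ) * N ^ (7 / 10 : ℝ) +
        A ^ (7 / 10 : ℝ) * M ^ (3 / 5 : ℝ) * N ^ (13 / 10 : ℝ) + A * N ^ (7 / 4 : ℝ) := by
  have hb : 0 < b := by linarith
  have hNb : 0 < N / b := div_pos hN hb
  obtain ⟨a, ha⟩ : ∃ a : ℝ, a = Real.log M := ⟨_, rfl⟩
  obtain ⟨n, hn⟩ : ∃ n : ℝ, n = Real.log N := ⟨_, rfl⟩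
  obtain ⟨l, hl⟩ : ∃ l : ℝ, l = Real.log b := ⟨_, rfl⟩
  obtain ⟨c, hc⟩ : ∃ c : ℝ, c = Real.log A := ⟨_, rfl⟩
  have hl0 : 0 ≤ l := hl ▸ Real.log_nonneg hb1
  have hln : l ≤ 1 / 2 * n := by
    have h1 : Real.log b ≤ Real.log (N ^ (1 / 2 : ℝ)) := Real.log_le_log hb hbN
    rw [Real.log_rpow hN, ← hl, ← hn] at h1
    exact h1
  have eM : ∀ e : ℝ, M ^ e = Real.exp (e * a) := fun e => by
    rw [Real.rpow_def_of_pos hM, mul_comm, ha]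
  have eN : ∀ e : ℝ, N ^ e = Real.exp (e * n) := fun e => by
    rw [Real.rpow_def_of_pos hN, mul_comm, hn]
  have eb : ∀ e : ℝ, b ^ e = Real.exp (e * l) := fun e => by
    rw [Real.rpow_def_of_pos hb, mul_comm, hl]
  have eA : ∀ e : ℝ, A ^ e = Real.exp (e * c) := fun e => by
    rw [Real.rpow_def_of_pos hA, mul_comm, hc]
  have eNb : ∀ e : ℝ, (N / b) ^ e = Real.exp (e * (n - l)) := fun e => by
    rw [Real.rpow_def_of_pos hNb, Real.log_div hN.ne' hb.ne', mul_comm, hn, hl]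
  have esb : Real.sqrt b = Real.exp (1 / 2 * l) := by rw [Real.sqrt_eq_rpow, eb]
  have ebNb : (b * (N / b)) ^ (1 / 2 : ℝ) = Real.exp (1 / 2 * n) := by
    rw [mul_div_cancel₀ _ hb.ne', eN]
  have eA1 : A = Real.exp c := by rw [hc, Real.exp_log hA]
  have eM1 : M = Real.exp a := by rw [ha, Real.exp_log hM]
  simp only [esb, ebNb, eb, eM, eN, eNb, eA]
  rw [eA1, eM1]
  have t1 : Real.exp (1 / 2 * l) * (Real.exp c * Real.exp a * Real.exp (1 / 2 * n)) ≤
      Real.exp c * Real.exp a * Real.exp (3 / 4 * n) := by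
    simp only [← Real.exp_add]
    exact Real.exp_le_exp.mpr (by linarith)
  have t2 : Real.exp (1 / 2 * l) * (Real.exp (3 / 4 * l) * Real.exp c * Real.exp (1 / 2 * a) *
      Real.exp (5 / 4 * (n - l))) ≤ Real.exp c * Real.exp (1 / 2 * a) * Real.exp (5 / 4 * n) := by
    simp only [← Real.exp_add]
    exact Real.exp_le_exp.mpr (by linarith)
  have t3 : Real.exp (1 / 2 * l) * (Real.exp c * Real.exp (6 / 5 * a) * Real.exp (1 / 10 * (n - l)) *
      Real.exp (-(2 / 5) * l)) ≤ Real.exp c * Real.exp (6 / 5 * a) * Real.exp (1 / 10 * n) := by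
    simp only [← Real.exp_add]
    exact Real.exp_le_exp.mpr (by linarith)
  have t4 : Real.exp (1 / 2 * l) * (Real.exp (1 / 5 * l) * Real.exp (2 / 5 * c) * Real.exp (6 / 5 * a) *
      Real.exp (7 / 10 * (n - l))) ≤ Real.exp (2 / 5 * c) * Real.exp (6 / 5 * a) * Real.exp (7 / 10 * n) := by
    simp only [← Real.exp_add]
    exact Real.exp_le_exp.mpr (by linarith)
  have t5 : Real.exp (1 / 2 * l) * (Real.exp (7 / 10 * c) * Real.exp (1 / 2 * l) * Real.exp (3 / 5 * a) *
      Real.exp (13 / 10 * (n - l))) ≤ Real.exp (7 / 10 * c) * Real.exp (3 / 5 * a) * Real.exp (13 / 10 * n) := by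
    simp only [← Real.exp_add]
    exact Real.exp_le_exp.mpr (by linarith)
  have t6 : Real.exp (1 / 2 * l) * (Real.exp (1 / 2 * l) * Real.exp c * Real.exp (7 / 4 * (n - l))) ≤
      Real.exp c * Real.exp (7 / 4 * n) := by
    simp only [← Real.exp_add]
    exact Real.exp_le_exp.mpr (by linarith)
  linarith [t1, t2, t3, t4, t5, t6]

/-- **The absorptions of §6, general `A`** ("`AM^{6/5}N^{1/10} ≪ AMN^{3/4}` if `M ≪ N²`", and
"`AM^{1/2}N^{5/4} ≪ AMN^{3/4} + AN^{7/4}`"): for `M, A > 0`, `N ≥ 1/2`, `M ≤ 4N²`,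
`AMN^{3/4} + AM^{1/2}N^{5/4} + AM^{6/5}N^{1/10} + A^{2/5}M^{6/5}N^{7/10} + A^{7/10}M^{3/5}N^{13/10} + AN^{7/4}
  ≤ 5 (AMN^{3/4} + AN^{7/4} + A^{2/5}M^{6/5}N^{7/10} + A^{7/10}M^{3/5}N^{13/10})`.
[cite: BettinChandee2018, §6] -/
theorem BC_terms6A_absorb {M N A : ℝ} (hM : 0 < M) (hN : 1 / 2 ≤ N) (hA : 0 < A)
    (hMN : M ≤ 4 * N ^ 2) :
    A * M * N ^ (3 / 4 : ℝ) + A * M ^ (1 / 2 : ℝ) * N ^ (5 / 4 : ℝ) +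
        A * M ^ (6 / 5 : ℝ) * N ^ (1 / 10 : ℝ) + A ^ (2 / 5 : ℝ) * M ^ (6 / 5 : ℝ) * N ^ (7 / 10 : ℝ) +
        A ^ (7 / 10 : ℝ) * M ^ (3 / 5 : ℝ) * N ^ (13 / 10 : ℝ) + A * N ^ (7 / 4 : ℝ) ≤
      5 * (A * M * N ^ (3 / 4 : ℝ) + A * N ^ (7 / 4 : ℝ) +
        A ^ (2 / 5 : ℝ) * M ^ (6 / 5 : ℝ) * N ^ (7 / 10 : ℝ) +
        A ^ (7 / 10 : ℝ) * M ^ (3 / 5 : ℝ) * N ^ (13 / 10 : ℝ)) := by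
  have h6 := BC_terms6_absorb hM hN hMN
  -- the two absorptions of the single-numerator lemma, times `A`
  have hN0 : 0 < N := by linarith
  obtain ⟨a, ha⟩ : ∃ a : ℝ, a = Real.log M := ⟨_, rfl⟩
  obtain ⟨n, hn⟩ : ∃ n : ℝ, n = Real.log N := ⟨_, rfl⟩
  have hlog2 : Real.log 2 < 0.6931471808 := Real.log_two_lt_d9
  have hn0 : -Real.log 2 ≤ n := by
    have h1 : Real.log (1 / 2) ≤ Real.log N := Real.log_le_log (by norm_num) hN
    rw [Real.log_div one_ne_zero two_ne_zero, Real.log_one, zero_sub, ← hn] at h1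
    exact h1
  have han : a ≤ 2 * n + Real.log 4 := by
    have h1 : Real.log M ≤ Real.log (4 * N ^ 2) := Real.log_le_log hM hMN
    rw [Real.log_mul (by norm_num) (by positivity), Real.log_pow, ← ha, ← hn] at h1
    push_cast at h1
    linarith
  have hlog4 : Real.log 4 = 2 * Real.log 2 := by
    rw [show (4 : ℝ) = 2 ^ 2 by norm_num, Real.log_pow]; push_cast; ring
  have eM : ∀ c : ℝ, M ^ c = Real.exp (c * a) := fun c => by
    rw [Real.rpow_def_of_pos hM, mul_comm, ha]
  have eN : ∀ c : ℝ, N ^ c = Real.exp (c * n) := fun c => by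
    rw [Real.rpow_def_of_pos hN0, mul_comm, hn]
  have eM1 : M = Real.exp a := by rw [ha, Real.exp_log hM]
  have h2 : M ^ (1 / 2 : ℝ) * N ^ (5 / 4 : ℝ) ≤ M * N ^ (3 / 4 : ℝ) + N ^ (7 / 4 : ℝ) := by
    rw [eM, eN, eM1, eN, eN, ← Real.exp_add, ← Real.exp_add]
    rcases le_total (a + 3 / 4 * n) (7 / 4 * n) with h | h
    · have : Real.exp (1 / 2 * a + 5 / 4 * n) ≤ Real.exp (7 / 4 * n) :=
        Real.exp_le_exp.mpr (by linarith)
      linarith [Real.exp_pos (a + 3 / 4 * n)]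
    · have : Real.exp (1 / 2 * a + 5 / 4 * n) ≤ Real.exp (a + 3 / 4 * n) :=
        Real.exp_le_exp.mpr (by linarith)
      linarith [Real.exp_pos (7 / 4 * n)]
  have h3 : M ^ (6 / 5 : ℝ) * N ^ (1 / 10 : ℝ) ≤ 3 * (M * N ^ (3 / 4 : ℝ)) := by
    rw [eM, eN, eM1, eN, ← Real.exp_add, ← Real.exp_add]
    have hexp1 : Real.exp 1 ≤ 3 := by have := Real.exp_one_lt_d9; linarith
    calc Real.exp (6 / 5 * a + 1 / 10 * n) ≤ Real.exp (1 + (a + 3 / 4 * n)) :=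
          Real.exp_le_exp.mpr (by linarith)
      _ = Real.exp 1 * Real.exp (a + 3 / 4 * n) := Real.exp_add _ _
      _ ≤ 3 * Real.exp (a + 3 / 4 * n) := by gcongr
  have h2A : A * M ^ (1 / 2 : ℝ) * N ^ (5 / 4 : ℝ) ≤ A * M * N ^ (3 / 4 : ℝ) + A * N ^ (7 / 4 : ℝ) := by
    have := mul_le_mul_of_nonneg_left h2 hA.le
    linarith [this]
  have h3A : A * M ^ (6 / 5 : ℝ) * N ^ (1 / 10 : ℝ) ≤ 3 * (A * M * N ^ (3 / 4 : ℝ)) := by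
    have := mul_le_mul_of_nonneg_left h3 hA.le
    linarith [this]
  have p1 : 0 ≤ A * M * N ^ (3 / 4 : ℝ) := by positivity
  have p2 : 0 ≤ A * N ^ (7 / 4 : ℝ) := by positivity
  have p3 : 0 ≤ A ^ (2 / 5 : ℝ) * M ^ (6 / 5 : ℝ) * N ^ (7 / 10 : ℝ) := by positivity
  have p4 : 0 ≤ A ^ (7 / 10 : ℝ) * M ^ (3 / 5 : ℝ) * N ^ (13 / 10 : ℝ) := by positivity
  linarith


/-! ### From (5.2) (general `A`, twisted) to (6.4) -/

/-- **One squarefull `b`** (the two cases `b ≤ N^{1/2}` — hypothesis (5.2) at `N' = N/b` — and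
`b > N^{1/2}` — the trivial bound — of Bettin–Chandee §6, for the twisted trilinear moments): for
`γ` with `γ_{n'} ≠ 0 ⇒ n'` squarefree, `(n',b) = 1`, `β_{bn'} ≠ 0` (e.g. `γ = β_b`),
`b^{1/2} 𝓒_b^{tw}(M,N/b,A;γ,ν) ≤ ‖γ‖²‖ν‖² (K E^ε W T₆(A,M,N) + 8AMN^{3/4})`, where
`E = (1+|ϑ|+|η|)AMN`, `W = 1 + (|ϑ|+|η|)A/(MN)` and
`T₆ = AMN^{3/4} + AM^{1/2}N^{5/4} + AM^{6/5}N^{1/10} + A^{2/5}M^{6/5}N^{7/10} + A^{7/10}M^{3/5}N^{13/10} + AN^{7/4}`.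
[cite: BettinChandee2018, §6 (6.1)–(6.2)] -/
theorem BC_sqrtb_CbA_le {ε K M N A : ℝ} (hK : 0 < K) (hM : 1 / 2 ≤ M) (hN : 1 / 2 ≤ N)
    (hNM : N ≤ M) (hA : 1 / 2 ≤ A) {ϑ : ℤ} (hϑ : ϑ ≠ 0) (η : ℝ) {β : ℕ → ℂ} (ν : ℕ → ℂ)
    (hβ : ∀ n : ℕ, β n ≠ 0 → N < n ∧ (n : ℝ) ≤ 2 * N)
    (hβk : ∀ n : ℕ, β n ≠ 0 → n.Coprime ϑ.natAbs)
    (hν : ∀ a : ℕ, ν a ≠ 0 → A < a ∧ (a : ℝ) ≤ 2 * A)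
    (h5 : ∀ (b : ℕ), 0 < b → (∀ p ∈ b.primeFactors, p ^ 2 ∣ b) →
      ∀ (M N' A : ℝ), 1 / 2 ≤ M → 1 / 2 ≤ N' → (b : ℝ) ≤ N' → (b : ℝ) * N' ≤ M → 1 / 2 ≤ A →
      ∀ (ϑ : ℤ), ϑ ≠ 0 → b.Coprime ϑ.natAbs → ∀ (η : ℝ) (γ ν : ℕ → ℂ),
        (∀ n : ℕ, γ n ≠ 0 → N' < n ∧ (n : ℝ) ≤ 2 * N') →
        (∀ n : ℕ, γ n ≠ 0 → Squarefree n ∧ n.Coprime b ∧ n.Coprime ϑ.natAbs) →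
        (∀ a : ℕ, ν a ≠ 0 → A < a ∧ (a : ℝ) ≤ 2 * A) →
        ∑ m ∈ (Ioc ⌊M⌋₊ ⌊2 * M⌋₊).filter (fun m => m.Coprime b),
            ‖∑ n' ∈ (Icc 1 ⌊2 * N'⌋₊).filter (fun n' => n'.Coprime m),
              γ n' * ∑ a ∈ Icc 1 ⌊2 * A⌋₊, ν a * Complex.exp (2 * Real.pi * Complex.I *
                ((ϑ : ℂ) * (a : ℂ) * ((((m : ZMod (b * n'))⁻¹).val : ℕ) : ℂ) / ((b * n' : ℕ) : ℂ) +
                  (η : ℂ) * (a : ℂ) / ((m : ℂ) * ((b * n' : ℕ) : ℂ))))‖ ^ 2 ≤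
          K * (∑ n ∈ Icc 1 ⌊2 * N'⌋₊, ‖γ n‖ ^ 2) * (∑ a ∈ Icc 1 ⌊2 * A⌋₊, ‖ν a‖ ^ 2) *
            ((1 + |(ϑ : ℝ)| + |η|) * ((b : ℝ) * M * N' * A)) ^ ε *
            (1 + (|(ϑ : ℝ)| + |η|) * A / ((b : ℝ) * N' * M)) *
            (A * M * ((b : ℝ) * N') ^ (1 / 2 : ℝ) +
              (b : ℝ) ^ (3 / 4 : ℝ) * A * M ^ (1 / 2 : ℝ) * N' ^ (5 / 4 : ℝ) +
              A * M ^ (6 / 5 : ℝ) * N' ^ (1 / 10 : ℝ) * (b : ℝ) ^ (-(2 / 5) : ℝ) +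
              (b : ℝ) ^ (1 / 5 : ℝ) * A ^ (2 / 5 : ℝ) * M ^ (6 / 5 : ℝ) * N' ^ (7 / 10 : ℝ) +
              A ^ (7 / 10 : ℝ) * (b : ℝ) ^ (1 / 2 : ℝ) * M ^ (3 / 5 : ℝ) * N' ^ (13 / 10 : ℝ) +
              (b : ℝ) ^ (1 / 2 : ℝ) * A * N' ^ (7 / 4 : ℝ)))
    {b : ℕ} (hb1 : 1 ≤ b) (hbfull : ∀ p ∈ b.primeFactors, p ^ 2 ∣ b) (γ : ℕ → ℂ)
    (hsupp : ∀ n' : ℕ, γ n' ≠ 0 → Squarefree n' ∧ n'.Coprime b ∧ β (b * n') ≠ 0) :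
    Real.sqrt b * ∑ m ∈ (Ioc ⌊M⌋₊ ⌊2 * M⌋₊).filter (fun m => m.Coprime b),
        ‖∑ n' ∈ (Icc 1 ⌊2 * (N / b)⌋₊).filter (fun n' => n'.Coprime m),
          γ n' * ∑ a ∈ Icc 1 ⌊2 * A⌋₊, ν a * Complex.exp (2 * Real.pi * Complex.I *
            ((ϑ : ℂ) * (a : ℂ) * ((((m : ZMod (b * n'))⁻¹).val : ℕ) : ℂ) / ((b * n' : ℕ) : ℂ) +
              (η : ℂ) * (a : ℂ) / ((m : ℂ) * ((b * n' : ℕ) : ℂ))))‖ ^ 2 ≤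
      (∑ n' ∈ Icc 1 ⌊2 * (N / b)⌋₊, ‖γ n'‖ ^ 2) * ((∑ a ∈ Icc 1 ⌊2 * A⌋₊, ‖ν a‖ ^ 2) *
        (K * ((1 + |(ϑ : ℝ)| + |η|) * (A * M * N)) ^ ε * (1 + (|(ϑ : ℝ)| + |η|) * A / (M * N)) *
          (A * M * N ^ (3 / 4 : ℝ) + A * M ^ (1 / 2 : ℝ) * N ^ (5 / 4 : ℝ) +
            A * M ^ (6 / 5 : ℝ) * N ^ (1 / 10 : ℝ) +
            A ^ (2 / 5 : ℝ) * M ^ (6 / 5 : ℝ) * N ^ (7 / 10 : ℝ) +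
            A ^ (7 / 10 : ℝ) * M ^ (3 / 5 : ℝ) * N ^ (13 / 10 : ℝ) + A * N ^ (7 / 4 : ℝ)) +
          8 * (A * M * N ^ (3 / 4 : ℝ)))) := by
  have hM0 : 0 < M := by linarith
  have hN0 : 0 < N := by linarith
  have hA0 : 0 < A := by linarith
  have hb0 : 0 < b := hb1
  have hbr : (0 : ℝ) < b := by exact_mod_cast hb0
  have hbr1 : (1 : ℝ) ≤ b := by exact_mod_cast hb1
  have hQ0 : 0 < M * N := mul_pos hM0 hN0
  have hW0 : 0 < 1 + (|(ϑ : ℝ)| + |η|) * A / (M * N) := by positivity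
  -- notation for the pieces (opaque abbreviations)
  obtain ⟨nb2, hnb2⟩ : ∃ x : ℝ, x = ∑ n' ∈ Icc 1 ⌊2 * (N / b)⌋₊, ‖γ n'‖ ^ 2 := ⟨_, rfl⟩
  have hnb0 : 0 ≤ nb2 := by rw [hnb2]; exact Finset.sum_nonneg fun _ _ => sq_nonneg _
  obtain ⟨nν2, hnν2⟩ : ∃ x : ℝ, x = ∑ a ∈ Icc 1 ⌊2 * A⌋₊, ‖ν a‖ ^ 2 := ⟨_, rfl⟩
  have hnν0 : 0 ≤ nν2 := by rw [hnν2]; exact Finset.sum_nonneg fun _ _ => sq_nonneg _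
  obtain ⟨Cb, hCb⟩ : ∃ x : ℝ, x = ∑ m ∈ (Ioc ⌊M⌋₊ ⌊2 * M⌋₊).filter (fun m => m.Coprime b),
      ‖∑ n' ∈ (Icc 1 ⌊2 * (N / b)⌋₊).filter (fun n' => n'.Coprime m),
        γ n' * ∑ a ∈ Icc 1 ⌊2 * A⌋₊, ν a * Complex.exp (2 * Real.pi * Complex.I *
          ((ϑ : ℂ) * (a : ℂ) * ((((m : ZMod (b * n'))⁻¹).val : ℕ) : ℂ) / ((b * n' : ℕ) : ℂ) +
            (η : ℂ) * (a : ℂ) / ((m : ℂ) * ((b * n' : ℕ) : ℂ))))‖ ^ 2 := ⟨_, rfl⟩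
  have hCb0 : 0 ≤ Cb := by rw [hCb]; exact Finset.sum_nonneg fun _ _ => sq_nonneg _
  obtain ⟨T6, hT6⟩ : ∃ T6 : ℝ, T6 = A * M * N ^ (3 / 4 : ℝ) + A * M ^ (1 / 2 : ℝ) * N ^ (5 / 4 : ℝ) +
      A * M ^ (6 / 5 : ℝ) * N ^ (1 / 10 : ℝ) + A ^ (2 / 5 : ℝ) * M ^ (6 / 5 : ℝ) * N ^ (7 / 10 : ℝ) +
      A ^ (7 / 10 : ℝ) * M ^ (3 / 5 : ℝ) * N ^ (13 / 10 : ℝ) + A * N ^ (7 / 4 : ℝ) := ⟨_, rfl⟩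
  have hT60 : 0 ≤ T6 := by
    have p1 : 0 ≤ A * M * N ^ (3 / 4 : ℝ) := by positivity
    have p2 : 0 ≤ A * M ^ (1 / 2 : ℝ) * N ^ (5 / 4 : ℝ) := by positivity
    have p3 : 0 ≤ A * M ^ (6 / 5 : ℝ) * N ^ (1 / 10 : ℝ) := by positivity
    have p4 : 0 ≤ A ^ (2 / 5 : ℝ) * M ^ (6 / 5 : ℝ) * N ^ (7 / 10 : ℝ) := by positivity
    have p5 : 0 ≤ A ^ (7 / 10 : ℝ) * M ^ (3 / 5 : ℝ) * N ^ (13 / 10 : ℝ) := by positivity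
    have p6 : 0 ≤ A * N ^ (7 / 4 : ℝ) := by positivity
    rw [hT6]; linarith
  obtain ⟨E, hE⟩ : ∃ E : ℝ, E = K * ((1 + |(ϑ : ℝ)| + |η|) * (A * M * N)) ^ ε *
      (1 + (|(ϑ : ℝ)| + |η|) * A / (M * N)) := ⟨_, rfl⟩
  have hE0 : 0 ≤ E := by rw [hE]; positivity
  have hMN34 : 0 ≤ 8 * (A * M * N ^ (3 / 4 : ℝ)) := by positivity
  -- restate the goal with the abbreviations
  suffices hgoal : Real.sqrt b * Cb ≤ nb2 * (nν2 * (E * T6 + 8 * (A * M * N ^ (3 / 4 : ℝ)))) by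
    rw [hCb, hnb2, hnν2, hE, hT6] at hgoal; exact hgoal
  by_cases hsqrtN : (b : ℝ) ≤ N ^ (1 / 2 : ℝ)
  · -- `b ≤ N^{1/2}`: the hypothesis (5.2), unless `γ = 0`
    by_cases hne : ∃ n' : ℕ, γ n' ≠ 0
    · obtain ⟨n₀, hn₀⟩ := hne
      obtain ⟨_, _, hβn₀⟩ := hsupp n₀ hn₀
      have hbk : b.Coprime ϑ.natAbs :=
        Nat.Coprime.coprime_dvd_left (Dvd.intro _ rfl) (hβk (b * n₀) hβn₀)
      have hNb : 1 / 2 ≤ N / b := by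
        have h1 := (hβ (b * n₀) hβn₀).2
        have hn₀1 : (1 : ℝ) ≤ n₀ := by
          have : n₀ ≠ 0 := by
            rintro rfl
            simp only [mul_zero] at hβn₀
            have := (hβ 0 hβn₀).1
            simp at this
            linarith
          exact_mod_cast Nat.one_le_iff_ne_zero.mpr this
        rw [le_div_iff₀ hbr]
        push_cast at h1
        nlinarith
      have hγ1 : ∀ n' : ℕ, γ n' ≠ 0 → N / b < n' ∧ (n' : ℝ) ≤ 2 * (N / b) := by
        intro n' hn'
        obtain ⟨_, _, hβn'⟩ := hsupp n' hn'
        obtain ⟨h1, h2⟩ := hβ (b * n') hβn'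
        push_cast at h1 h2
        constructor
        · rw [div_lt_iff₀ hbr]; linarith
        · rw [show 2 * (N / b) = 2 * N / b by ring, le_div_iff₀ hbr]; linarith
      have hγ2 : ∀ n' : ℕ, γ n' ≠ 0 → Squarefree n' ∧ n'.Coprime b ∧ n'.Coprime ϑ.natAbs := by
        intro n' hn'
        obtain ⟨hsqf, hcop, hβn'⟩ := hsupp n' hn'
        exact ⟨hsqf, hcop, Nat.Coprime.coprime_dvd_left (Dvd.intro_left _ rfl) (hβk (b * n') hβn')⟩
      have hbN' : (b : ℝ) ≤ N / b := by
        have h2 : (b : ℝ) * b ≤ N := by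
          have := mul_le_mul hsqrtN hsqrtN hbr.le (by positivity)
          rwa [← Real.sqrt_eq_rpow, Real.mul_self_sqrt hN0.le] at this
        rw [le_div_iff₀ hbr]; linarith
      have hbNM : (b : ℝ) * (N / b) ≤ M := by rw [mul_div_cancel₀ _ hbr.ne']; exact hNM
      have h := h5 b hb0 hbfull M (N / b) A hM hNb hbN' hbNM hA ϑ hϑ hbk η γ ν hγ1 hγ2 hν
      clear h5
      -- simplify `b M (N/b) A = AMN`, `1 + (…)A/(b (N/b) M) = 1 + (…)A/(MN)`
      have e1 : (1 + |(ϑ : ℝ)| + |η|) * ((b : ℝ) * M * (N / b) * A) =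
          (1 + |(ϑ : ℝ)| + |η|) * (A * M * N) := by
        rw [show (b : ℝ) * M * (N / b) * A = A * M * N by field_simp]
      have e2 : 1 + (|(ϑ : ℝ)| + |η|) * A / ((b : ℝ) * (N / b) * M) =
          1 + (|(ϑ : ℝ)| + |η|) * A / (M * N) := by
        rw [mul_div_cancel₀ _ hbr.ne', mul_comm N M]
      rw [e1, e2, ← hnb2, ← hnν2, ← hCb] at h
      have h' : Cb ≤ nb2 * nν2 * E *
          (A * M * ((b : ℝ) * (N / b)) ^ (1 / 2 : ℝ) +
            (b : ℝ) ^ (3 / 4 : ℝ) * A * M ^ (1 / 2 : ℝ) * (N / b) ^ (5 / 4 : ℝ) +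
            A * M ^ (6 / 5 : ℝ) * (N / b) ^ (1 / 10 : ℝ) * (b : ℝ) ^ (-(2 / 5) : ℝ) +
            (b : ℝ) ^ (1 / 5 : ℝ) * A ^ (2 / 5 : ℝ) * M ^ (6 / 5 : ℝ) * (N / b) ^ (7 / 10 : ℝ) +
            A ^ (7 / 10 : ℝ) * (b : ℝ) ^ (1 / 2 : ℝ) * M ^ (3 / 5 : ℝ) * (N / b) ^ (13 / 10 : ℝ) +
            (b : ℝ) ^ (1 / 2 : ℝ) * A * (N / b) ^ (7 / 4 : ℝ)) := by
        rw [hE]; calc _ ≤ _ := h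
          _ = _ := by ring
      have h52le : Real.sqrt b * (A * M * ((b : ℝ) * (N / b)) ^ (1 / 2 : ℝ) +
          (b : ℝ) ^ (3 / 4 : ℝ) * A * M ^ (1 / 2 : ℝ) * (N / b) ^ (5 / 4 : ℝ) +
          A * M ^ (6 / 5 : ℝ) * (N / b) ^ (1 / 10 : ℝ) * (b : ℝ) ^ (-(2 / 5) : ℝ) +
          (b : ℝ) ^ (1 / 5 : ℝ) * A ^ (2 / 5 : ℝ) * M ^ (6 / 5 : ℝ) * (N / b) ^ (7 / 10 : ℝ) +
          A ^ (7 / 10 : ℝ) * (b : ℝ) ^ (1 / 2 : ℝ) * M ^ (3 / 5 : ℝ) * (N / b) ^ (13 / 10 : ℝ) +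
          (b : ℝ) ^ (1 / 2 : ℝ) * A * (N / b) ^ (7 / 4 : ℝ)) ≤ T6 := by
        rw [hT6]; exact BC_terms52A_le hM0 hN0 hA0 hbr1 hsqrtN
      have hnE : 0 ≤ nb2 * nν2 * E := by positivity
      calc Real.sqrt b * Cb
          ≤ Real.sqrt b * (nb2 * nν2 * E *
            (A * M * ((b : ℝ) * (N / b)) ^ (1 / 2 : ℝ) +
              (b : ℝ) ^ (3 / 4 : ℝ) * A * M ^ (1 / 2 : ℝ) * (N / b) ^ (5 / 4 : ℝ) +
              A * M ^ (6 / 5 : ℝ) * (N / b) ^ (1 / 10 : ℝ) * (b : ℝ) ^ (-(2 / 5) : ℝ) +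
              (b : ℝ) ^ (1 / 5 : ℝ) * A ^ (2 / 5 : ℝ) * M ^ (6 / 5 : ℝ) * (N / b) ^ (7 / 10 : ℝ) +
              A ^ (7 / 10 : ℝ) * (b : ℝ) ^ (1 / 2 : ℝ) * M ^ (3 / 5 : ℝ) * (N / b) ^ (13 / 10 : ℝ) +
              (b : ℝ) ^ (1 / 2 : ℝ) * A * (N / b) ^ (7 / 4 : ℝ))) :=
            mul_le_mul_of_nonneg_left h' (Real.sqrt_nonneg _)
        _ = nb2 * nν2 * E * (Real.sqrt b *
            (A * M * ((b : ℝ) * (N / b)) ^ (1 / 2 : ℝ) +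
              (b : ℝ) ^ (3 / 4 : ℝ) * A * M ^ (1 / 2 : ℝ) * (N / b) ^ (5 / 4 : ℝ) +
              A * M ^ (6 / 5 : ℝ) * (N / b) ^ (1 / 10 : ℝ) * (b : ℝ) ^ (-(2 / 5) : ℝ) +
              (b : ℝ) ^ (1 / 5 : ℝ) * A ^ (2 / 5 : ℝ) * M ^ (6 / 5 : ℝ) * (N / b) ^ (7 / 10 : ℝ) +
              A ^ (7 / 10 : ℝ) * (b : ℝ) ^ (1 / 2 : ℝ) * M ^ (3 / 5 : ℝ) * (N / b) ^ (13 / 10 : ℝ) +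
              (b : ℝ) ^ (1 / 2 : ℝ) * A * (N / b) ^ (7 / 4 : ℝ))) := by ring
        _ ≤ nb2 * nν2 * E * T6 := mul_le_mul_of_nonneg_left h52le hnE
        _ ≤ nb2 * (nν2 * (E * T6 + 8 * (A * M * N ^ (3 / 4 : ℝ)))) := by
            have h0 : 0 ≤ nb2 * (nν2 * (8 * (A * M * N ^ (3 / 4 : ℝ)))) := by positivity
            have e : nb2 * (nν2 * (E * T6 + 8 * (A * M * N ^ (3 / 4 : ℝ)))) =
                nb2 * nν2 * E * T6 + nb2 * (nν2 * (8 * (A * M * N ^ (3 / 4 : ℝ)))) := by ring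
            rw [e]; exact le_add_of_nonneg_right h0
    · -- `γ = 0`: the second moment vanishes
      push Not at hne
      have h0 : Cb = 0 := by
        rw [hCb]; exact BC_CbAtw_eq_zero_of_forall b M A ϑ η ν (fun n _ => hne n)
      rw [h0, mul_zero]
      exact mul_nonneg hnb0 (mul_nonneg hnν0 (add_nonneg (mul_nonneg hE0 hT60) hMN34))
  · -- `b > N^{1/2}`: the trivial bound
    have hbN : N ^ (1 / 2 : ℝ) < b := not_le.mp hsqrtN
    have h1 : Cb ≤ 8 * A * M * (N / b) * nb2 * nν2 := by
      rw [hCb, hnb2, hnν2]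
      exact BC_CbAtw_trivial b hM0.le (div_pos hN0 hbr).le hA0.le ϑ η γ ν
    -- `√b · 8AM(N/b) = 8AMN/√b ≤ 8 A M N^{3/4}`
    have hsqb : Real.sqrt b * (8 * A * M * (N / b)) ≤ 8 * (A * M * N ^ (3 / 4 : ℝ)) := by
      have hsb : 0 < Real.sqrt b := Real.sqrt_pos.mpr hbr
      have e : Real.sqrt b * (8 * A * M * (N / b)) = 8 * A * M * N / Real.sqrt b := by
        rw [eq_div_iff hsb.ne']
        calc Real.sqrt b * (8 * A * M * (N / b)) * Real.sqrt b
            = 8 * A * M * N * (Real.sqrt b * Real.sqrt b / b) := by ring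
          _ = 8 * A * M * N := by rw [Real.mul_self_sqrt hbr.le, div_self hbr.ne', mul_one]
      rw [e, div_le_iff₀ hsb]
      have h2 : N ^ (1 / 4 : ℝ) ≤ Real.sqrt b := by
        rw [Real.sqrt_eq_rpow]
        calc N ^ (1 / 4 : ℝ) = (N ^ (1 / 2 : ℝ)) ^ (1 / 2 : ℝ) := by
              rw [← Real.rpow_mul hN0.le]; norm_num
          _ ≤ (b : ℝ) ^ (1 / 2 : ℝ) := Real.rpow_le_rpow (by positivity) hbN.le (by norm_num)
      have h3 : N = N ^ (3 / 4 : ℝ) * N ^ (1 / 4 : ℝ) := by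
        rw [← Real.rpow_add hN0]; norm_num
      calc 8 * A * M * N = 8 * (A * M * N ^ (3 / 4 : ℝ)) * N ^ (1 / 4 : ℝ) := by
            conv_lhs => rw [h3]
            ring
        _ ≤ 8 * (A * M * N ^ (3 / 4 : ℝ)) * Real.sqrt b := by gcongr
    calc Real.sqrt b * Cb ≤ Real.sqrt b * (8 * A * M * (N / b) * nb2 * nν2) :=
          mul_le_mul_of_nonneg_left h1 (Real.sqrt_nonneg _)
      _ = (Real.sqrt b * (8 * A * M * (N / b))) * (nb2 * nν2) := by ring
      _ ≤ 8 * (A * M * N ^ (3 / 4 : ℝ)) * (nb2 * nν2) :=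
          mul_le_mul_of_nonneg_right hsqb (by positivity)
      _ ≤ nb2 * (nν2 * (E * T6 + 8 * (A * M * N ^ (3 / 4 : ℝ)))) := by
          have h0 : 0 ≤ nb2 * (nν2 * (E * T6)) := by positivity
          have e : nb2 * (nν2 * (E * T6 + 8 * (A * M * N ^ (3 / 4 : ℝ)))) =
              nb2 * (nν2 * (E * T6)) + 8 * (A * M * N ^ (3 / 4 : ℝ)) * (nb2 * nν2) := by ring
          rw [e]; exact le_add_of_nonneg_left h0

end Literature.NumberTheory.LFunctions

end
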